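import Literature.NumberTheory.PAdicHodge.BmaxPlusTransportedReciprocityFormalPoint
import Literature.NumberTheory.PAdicHodge.TatePairingPointOfKTwoTransport
import HarnessLib

/-!
# Kato's explicit reciprocity law at a completion for a curve `W/K₀` ISOMORPHIC over `F = K_v` to a ramified good supersingular model —
# T5-B along the TRANSPORT matching `em = θ_∞ ≫ T_p(φ) ≫ e`

Topic `Literature/NumberTheory/PAdicHodge`; THEOREMS ONLY (no definition, no named fact, no instance, no `sorry`). The `φ`-twins of
`BmaxPlusTransportedReciprocityInputs` §3 (`exists_transported_kummer_data`) and `BmaxPlusTransportedReciprocityFormalPoint`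
(`exists_const_tatePairingPoint_eq_neg_trace_transported_formalPoint`), which treat the good `𝒪_D`-model `E = curveFO F (W_D ⊗_ψ 𝒪_F)` ITSELF
(canonical matching `θ_∞ ≫ tateGeomEquivTatePtOSS`, `φ = id`). Here `W` is any Weierstrass curve over a subfield `K₀ ⊆ F` together with a
`Γ_F`-equivariant isomorphism of geometric points `φ : (W ×_{K₀} F)(F̄) ≃ E(F̄)` and its Tate-module map `T_p(φ)` (brick G1,
`TatePairingPointOfKTwoTransport`: `em_transport_smul`, `em_transport_tadicKummer_eq_kummerCocycleO`, `map_divSeq(_fix)`); the K★ cells take `K₀ = ℚ`,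
`W = W_min` a globally minimal model, `F = ℚ_p(ζ_m)_w(ϖ)` and `φ` the admissible change of variables onto the good `𝒪_D`-model. Everything T5-B discharges
along the canonical matching is discharged along `em`: the `T`-adic Kummer cocycle `κ_Q` of `P ∈ W(F)` is carried to K1's `κ_u` with `uₙ = z(φ Qₙ)`,
the transported integrating pair `(f Λ_{Tu}, f φΛ_{Tu})` of the CM-fibre transport `Tu` of that tower integrates it, `θ`-value by T2c, (K₂) PROVED;
then the socket capstone with the transported Hodge pair (`BmaxPlusTransportedReciprocity`, any `W/K₀`, any equivariant matching) gives

* ★★ `exists_transported_kummer_data_transport` — the per-point data along `em`;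
* ★★★★ `exists_const_tatePairingPoint_eq_neg_trace_transported_formalPoint_transport` — ONE `c ∈ F` with
  **`⟨[η], P⟩_W = −Tr_{F/ℚ_p}(c_P · exp*_d(η) · c)`** for every cocycle `η` of `T_pW|_{Γ_F}`, every `P ∈ W(F)` whose image `φ Q₀` is a deep formal point
  of the model, every `c_P` with `ι(c_P) = p^N·Σ'[Xʲ]log_{W_D}·z(φ Q₀)ʲ` — modulo the Hodge line `(A, B, d)`, `(A, B) ≠ 0`, and `hne` in branch (a)
  (discharged on the Summits side by `exists_hodgePair_fil_and_hne`, as for `φ = id`).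

Purpose: crux K★ `stmt-BirchSwinnertonDyer-22226` (route `EdixhovenFibreFiveSeven`, line `kato_lever`), memo
`Summits/…/Cruxes/StarredOptimalManinUnitFiveSeven/Lines/kato-lever-seam-rec-at-cells.md` §5 (row `c′, hrec′`): Kato's formula for `W_min` itself over the
cell's field of good reduction, so that the descent / Galois averaging of `…ReciprocityTowerFromAbove` applies. Infrastructure only; BSD / K★ / [REC] are
NOT proved by this file.

## References
* K. Kato, LNM 1553 (1993), Ch. II Thm. 1.4.1, Lemma 1.4.3. [Kato1993LNM1553]
* S. Bloch, K. Kato (1990), Ex. 3.10.1, Example 3.11. [BlochKato1990]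
* N. Katz, *Crystalline cohomology, Dieudonné modules, and Jacobi sums* (1981), Thm. 5.1.4–5.1.5. [Katz1981CrystallineDieudonne]
* J. H. Silverman, *AEC* (2009), III §7, Prop. VII.2.2, VIII §2, X §4. [SilvermanAEC2009]
-/

noncomputable section

open Field Function ValuativeRel WittVector NumberField IsDedekindDomain
open scoped NumberField Topology

namespace Literature.NumberTheory.PAdicHodge

open Literature.NumberTheory.GaloisRepresentations
open Literature.NumberTheory.GaloisRepresentations.IsNonarchimedeanLocalField
open Literature.NumberTheory.GaloisRepresentations.LubinTate
open Literature.NumberTheory.GaloisCohomology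
open Literature.NumberTheory.EllipticCurves
open Literature.NumberTheory.EllipticCurves.FormalGroupChart
open Literature.NumberTheory.PAdicHodge.GaloisContinuity
open Literature.IUT.LogVolume
open Literature.RingTheory.FormalGroups Literature.AlgebraicGeometry.Resolution
open _root_.WeierstrassCurve

section Completion

variable {K : Type} [Field K] [NumberField K] {p : ℕ} [hprime : Fact p.Prime] (v : HeightOneSpectrum (𝓞 K))
  [CharZero (v.adicCompletion K)] [LocallyCompactSpace (absoluteGaloisGroup (v.adicCompletion K))]
  [Fact (¬ IsUnit (p : integerC (v.adicCompletion K)))]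
  [IsAdicComplete (Ideal.span {(p : integerC (v.adicCompletion K))}) (integerC (v.adicCompletion K))]
  [CharP 𝓀[v.adicCompletion K] p] [CharZero (CompletedAlgClosure (v.adicCompletion K))]
  (hpv : valuation (v.adicCompletion K) (p : v.adicCompletion K) < 1)
  (Dv : EisensteinRoot (v.adicCompletion K) p hpv) (Wm : WeierstrassCurve (EisensteinRoot.CoeffDisc Dv))
  (ψm : EisensteinRoot.CoeffDisc Dv →+* LTCoeff (v.adicCompletion K))
  (hψm : ∀ c, algebraMap (LTCoeff (v.adicCompletion K)) (v.adicCompletion K) (ψm c) = EisensteinRoot.CoeffDisc.toF Dv c)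
  (hp2 : p ≠ 2) (hΔ : IsUnit (Wm.map ψm).Δ) (hA : ((Wm.map ψm).map (AinfTop.redCoeff (v.adicCompletion K))).hasseCoeff p = 0)
  [(AinfTop.curveFO (v.adicCompletion K) (Wm.map ψm)).IsElliptic]
  [(curveOver (CompletedAlgClosure (v.adicCompletion K)) (Wm.map ψm)).IsElliptic]
  -- the curve `W/K₀`, the isomorphism of geometric points onto the good model, and its Tate-module map
  {K₀ : Type} [Field K₀] [CharZero K₀] (W : WeierstrassCurve K₀) [W.IsElliptic] [Algebra K₀ (v.adicCompletion K)]
  (φ : geomPoints (W.baseChange (v.adicCompletion K)) ≃+ (AinfTop.curveFO (v.adicCompletion K) (Wm.map ψm)).geomPoints)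
  (hφ : ∀ (σ : absoluteGaloisGroup (v.adicCompletion K)) (P : geomPoints (W.baseChange (v.adicCompletion K))), φ (σ • P) = σ • φ P)
  (Tφ : (W.baseChange (v.adicCompletion K)).tateModule p ≃ₗ[ℤ_[p]] (AinfTop.curveFO (v.adicCompletion K) (Wm.map ψm)).tateModule p)
  (hTφ : ∀ (a : (W.baseChange (v.adicCompletion K)).tateModule p) (n : ℕ), TateModule.proj p n (Tφ a) = φ (TateModule.proj p n a))
  -- the Weil tower of `W`
  (e : (k : ℕ) → geomTorsion W ((p ^ k : ℕ) : ℤ) → geomTorsion W ((p ^ k : ℕ) : ℤ) → AlgebraicClosure K₀)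
  (hμ : ∀ k S T, e k S T ^ (p ^ k) = 1) (hadd₁ : ∀ k S₁ S₂ T, e k (S₁ + S₂) T = e k S₁ T * e k S₂ T)
  (hadd₂ : ∀ k S T₁ T₂, e k S (T₁ + T₂) = e k S T₁ * e k S T₂)
  (hgal : ∀ k (σ : absoluteGaloisGroup K₀) (S T : geomTorsion W ((p ^ k : ℕ) : ℤ)), σ • e k S T = e k (σ • S) (σ • T))
  (hcompat : ∀ k (S T : geomTorsion W ((p ^ (k + 1) : ℕ) : ℤ)),
    e k (torsionMulHom W (p ^ (k + 1)) (p ^ k) p (pow_succ p k).symm S)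
      (torsionMulHom W (p ^ (k + 1)) (p ^ k) p (pow_succ p k).symm T) = e (k + 1) S T ^ p)

/-! ### §1 The per-point Kummer data along the transport matching -/

set_option maxHeartbeats 4800000 in
omit [LocallyCompactSpace (absoluteGaloisGroup (HeightOneSpectrum.adicCompletion K v))]
  [(AinfTop.curveFO (v.adicCompletion K) (Wm.map ψm)).IsElliptic] in
include hψm hφ hTφ in
/-- ★★ **The per-point Kummer data ALONG THE TRANSPORT MATCHING `em = θ_∞ ≫ T_p(φ) ≫ tateGeomEquivTatePtOSS`, with (K₂) PROVED** — the
`φ`-twin of `exists_transported_kummer_data` (`φ = id`): `W/K₀` (`K₀ ⊆ F`) with a `Γ_F`-equivariant isomorphism `φ` of geometric points onto the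
good model `E` and its Tate-module map `T_p(φ)`; `P ∈ W(F)` with a division sequence `Q` in `W(F̄)` whose image `φ Q₀` is a deep formal point of `E`.
Setting: good supersingular `𝒪_D`-model `E = curveFO F (W_D ⊗_ψ 𝒪_F)` congruent mod `ϖ` to `E₀/ℤ` (`E₀ ⊗ ℚ_p`, `E₀ ⊗ 𝔽_p` elliptic), transported period maps
`(LT, P⁰, Q⁰)` at index `N ≥ e` (`hLT hP₀ hQ₀`), Hodge line `(A, B, d)`. For `P ∈ E(F)` with a `p`-power division sequence `Q` (`Q₀ = P`) whose base is
a formal point with `‖z(P)‖^N ≤ ‖p‖`, and `c_P ∈ F` with `ι(c_P) = p^N·Σ'[Xʲ]log_{W_D}·z(P)ʲ`, there are a cocycle `κ` carrying the level Kummer classes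
of `P` and `b⁰_ω, b⁰_η ∈ B_dR⁺` with: `P⁰(em(κ τ)) = τb⁰_ω − b⁰_ω`, `Q⁰(em(κ τ)) = τb⁰_η − b⁰_η`, `θ(ι(A)b⁰_ω + ι(B)b⁰_η) = ι(c_P)`, and
**for every `a ∈ T_pE`: `∃ M, IsTeichLog 2 (p^M·(Q⁰(em a)·b⁰_ω − P⁰(em a)·b⁰_η))`** — `(b⁰_ω, b⁰_η) = (f Λ_{Tu}, f φΛ_{Tu})` for the CM-fibre
transport `Tu` of the Kummer tower `u = z(Q)`. [cite: Kato1993LNM1553, Ch. II Lemma 1.4.3] [cite: BlochKato1990, Ex. 3.10.1, Example 3.11]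
[cite: Katz1981CrystallineDieudonne, Thm. 5.1.4–5.1.5] [cite: SilvermanAEC2009, Prop. VII.2.2 and VIII §2] -/
theorem exists_transported_kummer_data_transport (E₀ : WeierstrassCurve ℤ)
    (hWE : Wm.map (Ideal.Quotient.mk (Ideal.span {EisensteinRoot.CoeffDisc.of Dv (AdjoinRoot.root Dv.poly)})) =
      (E₀.map (algebraMap ℤ (EisensteinRoot.CoeffDisc Dv))).map
        (Ideal.Quotient.mk (Ideal.span {EisensteinRoot.CoeffDisc.of Dv (AdjoinRoot.root Dv.poly)})))
    [(E₀.map (Int.castRingHom ℚ_[p])).IsElliptic] [(E₀.map (Int.castRingHom (ZMod p))).IsElliptic]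
    {N : ℕ} (hN : Dv.e ≤ N) {LT : AinfTop.TatePtO (v.adicCompletion K) (Wm.map ψm) p →+ BmaxPlus (v.adicCompletion K) p}
    {P₀ Q₀ : AinfTop.TatePtO (v.adicCompletion K) (Wm.map ψm) p →+ BdRPlusTop (v.adicCompletion K) p}
    (hLT : ∀ (τ : AinfTop.TatePtO (v.adicCompletion K) (Wm.map ψm) p) (w : ℕ → (maxNilIdealC (v.adicCompletion K)).toIdeal)
        (hw : ∀ n, AinfTop.mulPC (v.adicCompletion K) p E₀ (w (n + 1)) = w n)
        (_ : ∀ n, ‖(((w n : (maxNilIdealC (v.adicCompletion K)).toIdeal) : CBall (v.adicCompletion K)) : CompletedAlgClosure (v.adicCompletion K)) -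
          (((AinfTop.seqO (Wm.map ψm) τ n : (maxNilIdealC (v.adicCompletion K)).toIdeal) : CBall (v.adicCompletion K)) :
            CompletedAlgClosure (v.adicCompletion K))‖ ≤
          ‖((Dv.rootC : integerC (v.adicCompletion K)) : CompletedAlgClosure (v.adicCompletion K))‖)
        (z : bmaxZero (v.adicCompletion K) p), algebraMap (Ainf (p := p) (v.adicCompletion K)) (bmaxZero (v.adicCompletion K) p)
          ((AinfTop.of (v.adicCompletion K) p).symm (((AinfTop.divisionLiftPt E₀ (surjective_fontaineTheta_integerC hpv) w hw).val :
            (AinfTop.nilTheta (v.adicCompletion K) p (surjective_fontaineTheta_integerC hpv)).toIdeal) : AinfTop (v.adicCompletion K) p)) ^ N =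
          (p : bmaxZero (v.adicCompletion K) p) * z →
        LT τ = PadicLogSeries.logSum ((algebraMap (Ainf (p := p) (v.adicCompletion K)) (bmaxZero (v.adicCompletion K) p)).comp zpToAinf)
          (GaloisContinuity.formalLogNum E₀ p) N
          (algebraMap (Ainf (p := p) (v.adicCompletion K)) (bmaxZero (v.adicCompletion K) p)
            ((AinfTop.of (v.adicCompletion K) p).symm (((AinfTop.divisionLiftPt E₀ (surjective_fontaineTheta_integerC hpv) w hw).val :
              (AinfTop.nilTheta (v.adicCompletion K) p (surjective_fontaineTheta_integerC hpv)).toIdeal) : AinfTop (v.adicCompletion K) p))) z)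
    (hP₀ : ∀ τ, P₀ τ = BdRPlusTop.of (v.adicCompletion K) p (bmaxPlusToBdR (v.adicCompletion K) p (LT τ)))
    (hQ₀ : ∀ τ, Q₀ τ = BdRPlusTop.of (v.adicCompletion K) p (bmaxPlusToBdR (v.adicCompletion K) p (frobBmaxPlus (v.adicCompletion K) p (LT τ))))
    (A B : v.adicCompletion K) (dHL : ℕ)
    (hHL : ∀ n : ℕ, ‖(p : CompletedAlgClosure (v.adicCompletion K)) ^ dHL * PowerSeries.coeff n
        ((Wm.map ((CBall (v.adicCompletion K)).subtype.comp (EisensteinRoot.CoeffDisc.toCBall Dv))).formalLog -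
          PowerSeries.C (algebraMap (v.adicCompletion K) (CompletedAlgClosure (v.adicCompletion K)) A) *
            (E₀.map (Int.castRingHom (CompletedAlgClosure (v.adicCompletion K)))).formalLog -
          PowerSeries.C (algebraMap (v.adicCompletion K) (CompletedAlgClosure (v.adicCompletion K)) B) *
            PowerSeries.expand p hprime.out.ne_zero (E₀.map (Int.castRingHom (CompletedAlgClosure (v.adicCompletion K)))).formalLog)‖ ≤ 1)
    (P : (W.baseChange (v.adicCompletion K)).toAffine.Point)
    (Q : ℕ → geomPoints (W.baseChange (v.adicCompletion K)))
    (hQ : ∀ n, p • Q (n + 1) = Q n)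
    (hQ0 : Q 0 = toGeomPoints (W.baseChange (v.adicCompletion K)) P)
    (hP1 : AinfTop.geomToCO (Wm.map ψm) ((⇑φ ∘ Q) 0) ∈ kernel (NormedField.valuation (K := CompletedAlgClosure (v.adicCompletion K)))
      (curveOver (CompletedAlgClosure (v.adicCompletion K)) (Wm.map ψm)))
    (huN : ‖((zPt (AinfTop.geomToCO (Wm.map ψm) ((⇑φ ∘ Q) 0)) hP1 : CBall (v.adicCompletion K)) : CompletedAlgClosure (v.adicCompletion K))‖ ^ N ≤
      ‖(p : CompletedAlgClosure (v.adicCompletion K))‖)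
    (cP : v.adicCompletion K)
    (hcP : algebraMap (v.adicCompletion K) (CompletedAlgClosure (v.adicCompletion K)) cP =
      (p : CompletedAlgClosure (v.adicCompletion K)) ^ N *
        ∑' j : ℕ, PowerSeries.coeff j (Wm.map ((CBall (v.adicCompletion K)).subtype.comp (EisensteinRoot.CoeffDisc.toCBall Dv))).formalLog *
          ((zPt (AinfTop.geomToCO (Wm.map ψm) ((⇑φ ∘ Q) 0)) hP1 : CBall (v.adicCompletion K)) : CompletedAlgClosure (v.adicCompletion K)) ^ j) :
    let em : W.tateModule p ≃ₗ[ℤ_[p]] AinfTop.TatePtO (v.adicCompletion K) (Wm.map ψm) p :=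
      (tateModuleEquiv W (v.adicCompletion K) p).trans
        (Tφ.trans (AinfTop.tateGeomEquivTatePtOSS (v.adicCompletion K) (Wm.map ψm) p hp2 hΔ hA))
    let P₁ : W.tateModule p →+ BdRPlusTop (v.adicCompletion K) p := P₀.comp em.toAddMonoidHom
    let Q₁ : W.tateModule p →+ BdRPlusTop (v.adicCompletion K) p := Q₀.comp em.toAddMonoidHom
    ∃ (κ : contOneCocycles (restrictedTateRep W (v.adicCompletion K) p).toTopRep)
      (bω₀ bη₀ : BdRPlusTop (v.adicCompletion K) p),
      (∀ j, (cohomologyMap (tateProjMor W (v.adicCompletion K) p j) 1).hom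
          (oneCocycleClass _ κ) = kummerLevelClass W (v.adicCompletion K) p j P) ∧
      (∀ τ, P₁ (κ.1 τ) = BdRPlusTop.gal (v.adicCompletion K) p τ bω₀ - bω₀) ∧
      (∀ τ, Q₁ (κ.1 τ) = BdRPlusTop.gal (v.adicCompletion K) p τ bη₀ - bη₀) ∧
      thetaBdR ((BdRPlusTop.of (v.adicCompletion K) p).symm
        (BdRPlusTop.of (v.adicCompletion K) p (embBdRHom hpv (surjective_fontaineTheta_integerC hpv) A) * bω₀ +
          BdRPlusTop.of (v.adicCompletion K) p (embBdRHom hpv (surjective_fontaineTheta_integerC hpv) B) * bη₀)) =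
        algebraMap (v.adicCompletion K) (CompletedAlgClosure (v.adicCompletion K)) cP ∧
      ∀ a : W.tateModule p, ∃ M : ℕ,
        IsTeichLog 2 ((BdRPlusTop.of (v.adicCompletion K) p).symm ((p : BdRPlusTop (v.adicCompletion K) p) ^ M *
          (Q₁ a * bω₀ - P₁ a * bη₀))) := by
  intro em P₁ Q₁
  have hN1 : 1 ≤ N := Dv.e_pos.trans_le hN
  -- the `T`-adic Kummer cocycle of `P`, its level classes, and its image `κ_u` under `em`
  have hfix : ∀ σ : absoluteGaloisGroup (v.adicCompletion K), σ • Q 0 = Q 0 :=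
    gal_smul_divSeq_zero W (v.adicCompletion K) hQ0
  have hker := AinfTop.geomToCO_divSeq_mem_kernel (Wm.map ψm) hp2 hΔ hA (Q := ⇑φ ∘ Q) (map_divSeq W φ hQ) hP1
  obtain ⟨κ, hκ⟩ := exists_contOneCocycles_tadicKummer W (v.adicCompletion K) p hQ hfix
  have h1 := cohomologyMap_tateProjMor_oneCocycleClass_eq_kummerLevelClass W (v.adicCompletion K) p hQ hQ0 κ hκ
  have hemκ : ∀ τ, em (κ.1 τ) =
      AinfRamTop.kummerCocycleO Wm ψm hψm (fun n => zPt (AinfTop.geomToCO (Wm.map ψm) ((⇑φ ∘ Q) n)) (hker n))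
        (AinfTop.mulPC_zPt_divSeqO Wm ψm hψm (Q := ⇑φ ∘ Q) (map_divSeq W φ hQ) hker)
        (AinfTop.galCBall_zPt_divSeqO_zero Wm ψm (Q := ⇑φ ∘ Q) (map_divSeq_fix W φ hφ hfix) hker) τ :=
    em_transport_tadicKummer_eq_kummerCocycleO v W hpv Dv Wm ψm hψm hp2 hΔ hA φ hφ Tφ hTφ hQ hfix hker κ hκ
  -- the Kummer tower `u = z(Q)` of `Ŵ_D(𝔪_ℂ)`, its CM-fibre transport `Tu`, depth and witness
  have hup := AinfTop.mulPC_zPt_divSeqO Wm ψm hψm (Q := ⇑φ ∘ Q) (map_divSeq W φ hQ) hker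
  -- (the tower `u` is a lambda: pass it explicitly to the tower lemmas, whose `hup`-binders do not determine it by unification)
  obtain ⟨Tu, ⟨hTu, hTuv⟩, -⟩ := exists_unique_int_divisionSeq_of_ramified Dv Wm E₀ hWE
    (v := fun n => zPt (AinfTop.geomToCO (Wm.map ψm) ((⇑φ ∘ Q) n)) (hker n)) hup
  have hdepth := norm_transport_zero_pow_le_of_norm_pow_le Dv (u := fun n => zPt (AinfTop.geomToCO (Wm.map ψm) ((⇑φ ∘ Q) n)) (hker n))
    (Tu := Tu) hTuv hN huN
  have hmem := AinfTop.pow_coe_val_nsmul_divisionLiftPt_mem E₀ (hθ := surjective_fontaineTheta_integerC hpv) (u := Tu) hTu hdepth 1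
  rw [one_nsmul] at hmem
  obtain ⟨z, hz⟩ := exists_algebraMap_pow_eq_natCast_mul (F := (v.adicCompletion K)) (p := p) hmem
  -- the transported crystalline integrating pair `(b⁰_ω, b⁰_η) = (f Λ_{Tu}, f φΛ_{Tu})`
  obtain ⟨Λ, hΛdef⟩ : ∃ Λ' : BmaxPlus (v.adicCompletion K) p,
      Λ' = PadicLogSeries.logSum ((algebraMap (Ainf (p := p) (v.adicCompletion K)) (bmaxZero (v.adicCompletion K) p)).comp zpToAinf)
        (GaloisContinuity.formalLogNum E₀ p) N
        (algebraMap (Ainf (p := p) (v.adicCompletion K)) (bmaxZero (v.adicCompletion K) p)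
          ((AinfTop.of (v.adicCompletion K) p).symm (((AinfTop.divisionLiftPt E₀ (surjective_fontaineTheta_integerC hpv) Tu hTu).val :
            (AinfTop.nilTheta (v.adicCompletion K) p (surjective_fontaineTheta_integerC hpv)).toIdeal) : AinfTop (v.adicCompletion K) p))) z :=
    ⟨_, rfl⟩
  -- (the same element through `torsionLift`: `↑(divisionLiftPt …).val = torsionLift …` is `rfl`, `AinfTop.coe_val_divisionLiftPt`; T2c is stated with
  -- `torsionLift`, and we keep its output untouched — rewriting inside these large statements is prohibitively slow)
  have hΛdef' : Λ = PadicLogSeries.logSum ((algebraMap (Ainf (p := p) (v.adicCompletion K)) (bmaxZero (v.adicCompletion K) p)).comp zpToAinf)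
        (GaloisContinuity.formalLogNum E₀ p) N
        (algebraMap (Ainf (p := p) (v.adicCompletion K)) (bmaxZero (v.adicCompletion K) p)
          ((AinfTop.of (v.adicCompletion K) p).symm (AinfTop.torsionLift E₀ (surjective_fontaineTheta_integerC hpv) Tu hTu))) z := hΛdef
  have hpair := fun σ => transported_integrating_pair Dv Wm E₀ hWE ψm hψm (hθ := surjective_fontaineTheta_integerC hpv) hN hLT hP₀ hQ₀
    (u := fun n => zPt (AinfTop.geomToCO (Wm.map ψm) ((⇑φ ∘ Q) n)) (hker n)) hup (AinfTop.galCBall_zPt_divSeqO_zero Wm ψm (Q := ⇑φ ∘ Q) (map_divSeq_fix W φ hφ hfix) hker) huN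
    (Tu := Tu) hTu hTuv hz σ
  have hHonda := AinfTop.frobBmaxPlus_hondaTrace_logSum_divisionLiftPt_eq_zero E₀ (hθ := surjective_fontaineTheta_integerC hpv) (u := Tu)
    hTu hN1 hz
  have hz' : algebraMap (Ainf (p := p) (v.adicCompletion K)) (bmaxZero (v.adicCompletion K) p)
      ((AinfTop.of (v.adicCompletion K) p).symm (AinfTop.torsionLift E₀ (surjective_fontaineTheta_integerC hpv) Tu hTu)) ^ N =
      (p : bmaxZero (v.adicCompletion K) p) * z := by
    have h := hz
    rw [AinfTop.coe_val_divisionLiftPt] at h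
    exact h
  have hθb := AinfRamTop.thetaBdR_transportedHodgeCombination_eq Dv (hθ := surjective_fontaineTheta_integerC hpv) Wm E₀ A B dHL hHL
    (fun n => zPt (AinfTop.geomToCO (Wm.map ψm) ((⇑φ ∘ Q) n)) (hker n)) Tu hup hTu hTuv hN1 hz'
  refine ⟨κ, BdRPlusTop.of (v.adicCompletion K) p (bmaxPlusToBdR (v.adicCompletion K) p Λ),
    BdRPlusTop.of (v.adicCompletion K) p (bmaxPlusToBdR (v.adicCompletion K) p (frobBmaxPlus (v.adicCompletion K) p Λ)), h1,
    fun τ => ?_, fun τ => ?_, ?_, fun a => ?_⟩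
  · -- `P₁(κ τ) = τ b⁰_ω − b⁰_ω`
    -- (no `rw` inside the large integrating-pair statements: unfold the abbreviation `Λ` in the SMALL goal and close by `exact`)
    change P₀ (em (κ.1 τ)) = _
    rw [hemκ τ, hΛdef]
    exact (hpair τ).1
  · -- `Q₁(κ τ) = τ b⁰_η − b⁰_η`
    change Q₀ (em (κ.1 τ)) = _
    rw [hemκ τ, hΛdef]
    exact (hpair τ).2
  · -- `θ(ι(A) b⁰_ω + ι(B) b⁰_η) = p^N·log_{W_D}(z(P)) = ι(c_P)`
    rw [map_add, map_mul, map_mul, RingEquiv.symm_apply_apply, RingEquiv.symm_apply_apply, RingEquiv.symm_apply_apply,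
      RingEquiv.symm_apply_apply, hcP, hΛdef']
    exact hθb
  · -- (K₂) at `a`: PROVED (Dieudonné–Honda + fundamental exact sequence)
    obtain ⟨w, ⟨hw, hwv⟩, -⟩ := exists_unique_transport_seqO Dv Wm E₀ hWE ψm hψm (em a)
    change ∃ M : ℕ, IsTeichLog 2 ((BdRPlusTop.of (v.adicCompletion K) p).symm ((p : BdRPlusTop (v.adicCompletion K) p) ^ M *
      (Q₀ (em a) * BdRPlusTop.of (v.adicCompletion K) p (bmaxPlusToBdR (v.adicCompletion K) p Λ) -
        P₀ (em a) * BdRPlusTop.of (v.adicCompletion K) p (bmaxPlusToBdR (v.adicCompletion K) p (frobBmaxPlus (v.adicCompletion K) p Λ)))))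
    rw [hΛdef]
    exact isTeichLog_transported_resolution (D := Dv) (W := Wm) (E₀ := E₀) (ψ := ψm) (hθ := surjective_fontaineTheta_integerC hpv)
      (surjective_fontaineTheta_integerC hpv) hpv hN hLT hP₀ hQ₀ hHonda (em a) hw hwv (k := 2) (by norm_num)

/-! ### §2 Kato's formula for `W` at the points mapping to deep formal points of the model -/

set_option maxHeartbeats 4800000 in
include hgal hp2 hΔ hA hψm hφ hTφ in
/-- ★★★★ **Kato's explicit reciprocity law at `F = K_v` for a curve `W/K₀` ISOMORPHIC over `F` to a RAMIFIED good supersingular model `W_D ≡ E₀ (mod ϖ)`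
(along the transport matching `θ_∞ ≫ T_p(φ) ≫ e`), at EVERY cocycle of `T_pW|_{Γ_F}` and EVERY point of `W(F)` whose image `φ Q₀` is a deep formal point of the model —
no (K₂), no cocycle, no integrating-pair, no `Fil¹`/non-degeneracy hypothesis; pairing, `exp*`, `d` and representation are those of `W` ITSELF.**
The `φ`-twin of `exists_const_tatePairingPoint_eq_neg_trace_transported_formalPoint` (`φ = id`). Inputs: the cell data (Weil tower `e` with
`heL/healt/henondeg`, `ψ = log χ`, the de Rham binders `hinj / hde / d`), the good supersingular `ℤ`-curve `E₀` (`p ≥ 5`, `p ∤ Δ(E₀)`, Hasse `0`) with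
`W_D ≡ E₀ (mod ϖ)`, the transported period maps `(LT, P⁰, Q⁰)` at an index `N ≥ e` with their specification (from `exists_transported_periodHoms`),
a Hodge line `(A, B, d)` with `(A, B) ≠ 0`, and `hne` in branch (a): `(∃ τ, θ(P⁰τ) ≠ 0) → ∃ τ, ι(A)P⁰τ + ι(B)Q⁰τ ≠ 0`. Then there is ONE `c ∈ F`
such that for every `η ∈ Z¹(Γ_F, T_pW)`, every `P ∈ W(F)` with a `p`-power division sequence `Q` in `W(F̄)` (`Q₀ = P`) whose image `φ Q₀` is a formal point
of `E` with `‖z(φ Q₀)‖^N ≤ ‖p‖`, and every `c_P ∈ F` with `ι(c_P) = p^N·Σ'[Xʲ]log_{W_D}·z(φ Q₀)ʲ`: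

  **`⟨[η], P⟩ = −Tr_{F/ℚ_p}(c_P · exp*_d(η) · c)`.**

[cite: Kato1993LNM1553, Ch. II Thm. 1.4.1 (3)–(4) and Lemma 1.4.3] [cite: BlochKato1990, Ex. 3.10.1, Example 3.11]
[cite: Colmez1992PeriodesAbeliennes, §2] [cite: Katz1981CrystallineDieudonne, Thm. 5.1.4–5.1.5] [cite: SilvermanAEC2009, Prop. VII.2.2 and VIII §2] -/
theorem exists_const_tatePairingPoint_eq_neg_trace_transported_formalPoint_transport (hp5 : 5 ≤ p)
    (E₀ : WeierstrassCurve ℤ)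
    (hWE : Wm.map (Ideal.Quotient.mk (Ideal.span {EisensteinRoot.CoeffDisc.of Dv (AdjoinRoot.root Dv.poly)})) =
      (E₀.map (algebraMap ℤ (EisensteinRoot.CoeffDisc Dv))).map
        (Ideal.Quotient.mk (Ideal.span {EisensteinRoot.CoeffDisc.of Dv (AdjoinRoot.root Dv.poly)})))
    (hΔ₀ : ¬ (p : ℤ) ∣ E₀.Δ) (hA₀ : (E₀.map (Int.castRingHom (ZMod p))).hasseCoeff p = 0)
    [(E₀.map (Int.castRingHom ℚ_[p])).IsElliptic] [(E₀.map (Int.castRingHom (ZMod p))).IsElliptic]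
    [(curveOver (CompletedAlgClosure (v.adicCompletion K)) E₀).IsElliptic]
    {N : ℕ} (hN : Dv.e ≤ N) {LT : AinfTop.TatePtO (v.adicCompletion K) (Wm.map ψm) p →+ BmaxPlus (v.adicCompletion K) p}
    {P₀ Q₀ : AinfTop.TatePtO (v.adicCompletion K) (Wm.map ψm) p →+ BdRPlusTop (v.adicCompletion K) p}
    (hLT : ∀ (τ : AinfTop.TatePtO (v.adicCompletion K) (Wm.map ψm) p) (w : ℕ → (maxNilIdealC (v.adicCompletion K)).toIdeal)
        (hw : ∀ n, AinfTop.mulPC (v.adicCompletion K) p E₀ (w (n + 1)) = w n)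
        (_ : ∀ n, ‖(((w n : (maxNilIdealC (v.adicCompletion K)).toIdeal) : CBall (v.adicCompletion K)) : CompletedAlgClosure (v.adicCompletion K)) -
          (((AinfTop.seqO (Wm.map ψm) τ n : (maxNilIdealC (v.adicCompletion K)).toIdeal) : CBall (v.adicCompletion K)) :
            CompletedAlgClosure (v.adicCompletion K))‖ ≤
          ‖((Dv.rootC : integerC (v.adicCompletion K)) : CompletedAlgClosure (v.adicCompletion K))‖)
        (z : bmaxZero (v.adicCompletion K) p), algebraMap (Ainf (p := p) (v.adicCompletion K)) (bmaxZero (v.adicCompletion K) p)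
          ((AinfTop.of (v.adicCompletion K) p).symm (((AinfTop.divisionLiftPt E₀ (surjective_fontaineTheta_integerC hpv) w hw).val :
            (AinfTop.nilTheta (v.adicCompletion K) p (surjective_fontaineTheta_integerC hpv)).toIdeal) : AinfTop (v.adicCompletion K) p)) ^ N =
          (p : bmaxZero (v.adicCompletion K) p) * z →
        LT τ = PadicLogSeries.logSum ((algebraMap (Ainf (p := p) (v.adicCompletion K)) (bmaxZero (v.adicCompletion K) p)).comp zpToAinf)
          (GaloisContinuity.formalLogNum E₀ p) N
          (algebraMap (Ainf (p := p) (v.adicCompletion K)) (bmaxZero (v.adicCompletion K) p)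
            ((AinfTop.of (v.adicCompletion K) p).symm (((AinfTop.divisionLiftPt E₀ (surjective_fontaineTheta_integerC hpv) w hw).val :
              (AinfTop.nilTheta (v.adicCompletion K) p (surjective_fontaineTheta_integerC hpv)).toIdeal) : AinfTop (v.adicCompletion K) p))) z)
    (hP₀ : ∀ τ, P₀ τ = BdRPlusTop.of (v.adicCompletion K) p (bmaxPlusToBdR (v.adicCompletion K) p (LT τ)))
    (hQ₀ : ∀ τ, Q₀ τ = BdRPlusTop.of (v.adicCompletion K) p (bmaxPlusToBdR (v.adicCompletion K) p (frobBmaxPlus (v.adicCompletion K) p (LT τ))))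
    (hP₀Z : ∀ (c : ℤ_[p]) (τ : AinfTop.TatePtO (v.adicCompletion K) (Wm.map ψm) p),
      P₀ (c • τ) = BdRPlusTop.of (v.adicCompletion K) p (qpToBdR (c : ℚ_[p])) * P₀ τ)
    (hQ₀Z : ∀ (c : ℤ_[p]) (τ : AinfTop.TatePtO (v.adicCompletion K) (Wm.map ψm) p),
      Q₀ (c • τ) = BdRPlusTop.of (v.adicCompletion K) p (qpToBdR (c : ℚ_[p])) * Q₀ τ)
    (hP₀g : ∀ (σ : absoluteGaloisGroup (v.adicCompletion K)) (τ : AinfTop.TatePtO (v.adicCompletion K) (Wm.map ψm) p),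
      BdRPlusTop.gal (v.adicCompletion K) p σ (P₀ τ) = P₀ (σ • τ))
    (hQ₀g : ∀ (σ : absoluteGaloisGroup (v.adicCompletion K)) (τ : AinfTop.TatePtO (v.adicCompletion K) (Wm.map ψm) p),
      BdRPlusTop.gal (v.adicCompletion K) p σ (Q₀ τ) = Q₀ (σ • τ))
    (A B : v.adicCompletion K) (dHL : ℕ)
    (hHL : ∀ n : ℕ, ‖(p : CompletedAlgClosure (v.adicCompletion K)) ^ dHL * PowerSeries.coeff n
        ((Wm.map ((CBall (v.adicCompletion K)).subtype.comp (EisensteinRoot.CoeffDisc.toCBall Dv))).formalLog -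
          PowerSeries.C (algebraMap (v.adicCompletion K) (CompletedAlgClosure (v.adicCompletion K)) A) *
            (E₀.map (Int.castRingHom (CompletedAlgClosure (v.adicCompletion K)))).formalLog -
          PowerSeries.C (algebraMap (v.adicCompletion K) (CompletedAlgClosure (v.adicCompletion K)) B) *
            PowerSeries.expand p hprime.out.ne_zero (E₀.map (Int.castRingHom (CompletedAlgClosure (v.adicCompletion K)))).formalLog)‖ ≤ 1)
    (hAB : A ≠ 0 ∨ B ≠ 0)
    (hne_a : (∃ τ, thetaBdR ((BdRPlusTop.of (v.adicCompletion K) p).symm (P₀ τ)) ≠ 0) →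
      ∃ τ, BdRPlusTop.of (v.adicCompletion K) p (embBdRHom hpv (surjective_fontaineTheta_integerC hpv) A) * P₀ τ +
        BdRPlusTop.of (v.adicCompletion K) p (embBdRHom hpv (surjective_fontaineTheta_integerC hpv) B) * Q₀ τ ≠ 0)
    (ψ : C(absoluteGaloisGroup (v.adicCompletion K), ℤ_[p])) (hψ : ∀ σ τ, ψ (σ * τ) = ψ σ + ψ τ)
    (hψlog : ∀ τ, (ψ τ : ℚ_[p]) = logCyclotomic (F := (v.adicCompletion K)) p τ)
    (heL : ∀ (c : ℤ_[p]) (S U : W.tateModule p),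
      (weilContPairingPadic W (v.adicCompletion K) p e hμ hadd₁ hadd₂ hgal hcompat).toLin (c • S) U =
      twistHom (v.adicCompletion K) p ((weilContPairingPadic W (v.adicCompletion K) p e hμ hadd₁ hadd₂ hgal hcompat).toLin S U) c)
    (healt : ∀ S : W.tateModule p,
      (weilContPairingPadic W (v.adicCompletion K) p e hμ hadd₁ hadd₂ hgal hcompat).toLin S S = 0)
    (henondeg : ∀ S : W.tateModule p,
      (∀ U, (weilContPairingPadic W (v.adicCompletion K) p e hμ hadd₁ hadd₂ hgal hcompat).toLin S U = 0) → S = 0)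
    (hinj : letI := LocalField.padicAlgebra (v.adicCompletion K) p hpv
      (bdRPeriodRingData (F := (v.adicCompletion K)) (p := p) hpv).CupLogInjective (logCyclotomic p)
        (restrictedRationalTateRep W (v.adicCompletion K) p))
    (hde : letI := LocalField.padicAlgebra (v.adicCompletion K) p hpv
      ∀ η : contOneCocycles (restrictedTateRep W (v.adicCompletion K) p).toTopRep,
        (bdRPeriodRingData (F := (v.adicCompletion K)) (p := p) hpv).HasDualExp (logCyclotomic p)
          (restrictedRationalTateRep W (v.adicCompletion K) p)
          fun σ => TateModule.toRational p (η.1 σ))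
    (d : letI := LocalField.padicAlgebra (v.adicCompletion K) p hpv
      (bdRPeriodRingData (F := (v.adicCompletion K)) (p := p) hpv).FilZeroLine
        (restrictedRationalTateRep W (v.adicCompletion K) p)) :
    letI := LocalField.padicAlgebra (v.adicCompletion K) p hpv
    ∃ c : v.adicCompletion K,
      ∀ (η : contOneCocycles (restrictedTateRep W (v.adicCompletion K) p).toTopRep)
        (P : (W.baseChange (v.adicCompletion K)).toAffine.Point)
        (Q : ℕ → geomPoints (W.baseChange (v.adicCompletion K)))
        (hQ : ∀ n, p • Q (n + 1) = Q n)
        (_hQ0 : Q 0 = toGeomPoints (W.baseChange (v.adicCompletion K)) P)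
        (hP1 : AinfTop.geomToCO (Wm.map ψm) ((⇑φ ∘ Q) 0) ∈ kernel (NormedField.valuation (K := CompletedAlgClosure (v.adicCompletion K)))
          (curveOver (CompletedAlgClosure (v.adicCompletion K)) (Wm.map ψm))),
        ‖((zPt (AinfTop.geomToCO (Wm.map ψm) ((⇑φ ∘ Q) 0)) hP1 : CBall (v.adicCompletion K)) : CompletedAlgClosure (v.adicCompletion K))‖ ^ N ≤
            ‖(p : CompletedAlgClosure (v.adicCompletion K))‖ →
        ∀ cP : v.adicCompletion K,
          algebraMap (v.adicCompletion K) (CompletedAlgClosure (v.adicCompletion K)) cP =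
            (p : CompletedAlgClosure (v.adicCompletion K)) ^ N *
              ∑' j : ℕ, PowerSeries.coeff j (Wm.map ((CBall (v.adicCompletion K)).subtype.comp (EisensteinRoot.CoeffDisc.toCBall Dv))).formalLog *
                ((zPt (AinfTop.geomToCO (Wm.map ψm) ((⇑φ ∘ Q) 0)) hP1 : CBall (v.adicCompletion K)) : CompletedAlgClosure (v.adicCompletion K)) ^ j →
          ((tatePairingPoint W (v.adicCompletion K) p e hμ hadd₁ hadd₂ hgal hcompat
              (oneCocycleClass _ η) P : ℤ_[p]) : ℚ_[p]) =
            -Algebra.trace ℚ_[p] (v.adicCompletion K) (cP * (expStarCoord W hpv d η * c)) := by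
  have hprime' : p.Prime := Fact.out
  haveI := module_free_tateModule_holds (AinfTop.curveFO (v.adicCompletion K) (Wm.map ψm)) p
  haveI := module_finite_tateModule_holds (AinfTop.curveFO (v.adicCompletion K) (Wm.map ψm)) p
  haveI := module_free_tateModule_holds W p
  haveI := module_finite_tateModule_holds W p
  -- a nonzero element of `T_pŴ_D` (rank two of `T_pE` and the canonical matching)
  have hex : ∃ τ₀ : AinfTop.TatePtO (v.adicCompletion K) (Wm.map ψm) p, τ₀ ≠ 0 := by
    let b2 := Module.finBasisOfFinrankEq ℤ_[p] ((AinfTop.curveFO (v.adicCompletion K) (Wm.map ψm)).tateModule p)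
      (finrank_tateModule_eq_two_holds (AinfTop.curveFO (v.adicCompletion K) (Wm.map ψm)) p (Nat.cast_ne_zero.2 hprime'.ne_zero))
    exact ⟨((tateModuleEquiv (AinfTop.curveFO (v.adicCompletion K) (Wm.map ψm)) (v.adicCompletion K) p).trans
        (AinfTop.tateGeomEquivTatePtOSS (v.adicCompletion K) (Wm.map ψm) p hp2 hΔ hA)) (b2 0),
      fun h => b2.ne_zero 0 (((tateModuleEquiv (AinfTop.curveFO (v.adicCompletion K) (Wm.map ψm)) (v.adicCompletion K) p).trans
        (AinfTop.tateGeomEquivTatePtOSS (v.adicCompletion K) (Wm.map ψm) p hp2 hΔ hA)).map_eq_zero_iff.1 h)⟩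
  -- THE BRANCH: the recombined pair `Pω″ = ι(A)P⁰ + ι(B)Q⁰ ⊆ Fil¹`, `Pη″ = ι(C)P⁰ + ι(C′)Q⁰`, with `hne`, `hnot`
  obtain ⟨C, C', Pω₀, Pη₀, hPω₀, hPη₀, hfil₀, hne₀, hnot₀⟩ := exists_transported_etaPartner hpv Dv Wm E₀ hWE ψm hψm hN hLT hP₀ hQ₀ A B dHL
    hHL hp5 hΔ₀ hA₀ hAB hex hne_a
  -- FILE A: the capstone with the recombined transported pair along the canonical matching (partial application, then the line `d`)
  have hpart := exists_const_tatePairingPoint_eq_neg_trace_of_KTwo_transported_of_matching v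
    W e hμ hadd₁ hadd₂ hgal hcompat hpv Dv Wm E₀ hWE ψm hψm
    ((tateModuleEquiv W (v.adicCompletion K) p).trans
      (Tφ.trans (AinfTop.tateGeomEquivTatePtOSS (v.adicCompletion K) (Wm.map ψm) p hp2 hΔ hA)))
    (em_transport_smul v W hpv Dv Wm ψm hp2 hΔ hA φ hφ Tφ hTφ) hN hLT hP₀ hQ₀ hP₀Z hQ₀Z hP₀g hQ₀g A B C C' hAB hPω₀ hPη₀ hfil₀ hne₀ hnot₀ ψ hψ hψlog
    heL healt henondeg hinj hde
  obtain ⟨cL, c, -, -, hmain⟩ := hpart d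
  clear hpart
  -- the per-point Kummer data along the canonical matching, with (K₂) PROVED
  -- (STEPWISE application: a one-shot application of this many-binder theorem costs a prohibitive amount of elaboration)
  have hB3 := exists_transported_kummer_data_transport v hpv Dv Wm ψm hψm hp2 hΔ hA W φ hφ Tφ hTφ E₀ hWE (N := N) hN (LT := LT) (P₀ := P₀) (Q₀ := Q₀)
  have hB3' := hB3 hLT
  have hB3'' := hB3' hP₀ hQ₀ A B dHL
  have hdata := hB3'' hHL
  clear hB3 hB3' hB3''
  refine ⟨c, fun η P Q hQ hQ0 hP1 huN cP hcP => ?_⟩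
  have hdataP := hdata P Q hQ hQ0 hP1
  have hdataP' := hdataP huN cP hcP
  obtain ⟨κ, bω₀, bη₀, h1, h2, h3, h4, hK⟩ := hdataP'
  exact hmain η κ P h1 bω₀ bη₀ cP h2 h3 h4 (Module.Free.chooseBasis ℤ_[p] _) fun i => hK _

end Completion

end Literature.NumberTheory.PAdicHodge

end
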